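import Summits.RiemannHypothesis.RiemannHypothesis.Theorems.HandoffWindow
import Literature.NumberTheory.LFunctions.WeilThreePrimeSliver
import HarnessLib

/-!
# HANDOFF, the edge-layer cap: `|k(log q)| ≤ ½‖g‖₂²` on the window, hence `|contribution_q(g)| ≤ (log q/√q)‖g‖₂²` and the SHARP necessary condition `deficit ≤ cap·‖g‖²` (cell rh-explicit, TRACK «HANDOFF», seat theory-2)

HONEST FRAMING. Nothing here proves or approaches RH. On the handoff window of the consecutive primes `q < q'` a test
function `g ∈ C(t)`, `t ≤ (log q')/2 < log q =: L`, meets its own translate by `L` only through the two EDGE LAYERS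
`A = [L − t, t]` and `B = A − L = [−t, t − L]`, which are DISJOINT; hence the autocorrelation at lag `L` obeys the sharp bound
`|k(L)| ≤ ½‖g‖₂²` — this is the tree's SLIVER bound `norm_weilConv_weilReflect_le_half` / `…_add_neg_le` (`WeilThreePrimeSliver.lean`;
Bombieri's Lemma 2 `norm_weilConv_weilReflect_le` has constant `1`), imported, not re-proved — so the contribution of the
place `q` obeys `|contribution_q(g)| ≤ cap(q)‖g‖₂²`, `cap(q) = (log q)/√q = w_q/2` (HANDOFF-STATEMENT §A.4, §D.1; MARGIN-LAW §1.2 —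
on paper there; typed here), and `H(q)` implies the SHARP aggregate necessary condition `deficit_q(g) ≤ cap(q)‖g‖₂²` on the whole
window — the ceiling `r ≤ 1` of conj-1's sealed load variable `r = D_q/cap(q)` (PREREG-H7-H11), now THEOREM-grade under `H(q)`, hence
under RH for every `q` (`deficit_le_cap_of_riemannHypothesis`).  The only arithmetic input is `q' < q²` (Bertrand and «`q²` is not prime»),
which puts the whole window strictly below `log q`.

References: E. Bombieri, Rend. Mat. Acc. Lincei (9) 11 (2000) §4 Lemma 2 (the crude bound; `Bombieri2000Weil`); A. Connes, C. Consani,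
Enseign. Math. 69 (2023) §2.2–2.3 (the contribution of `p = 2` on `log 2 ≤ L < log 3`; `ConnesConsani2023`).
-/

set_option linter.dupNamespace false  -- the mandated namespace repeats `RiemannHypothesis`

noncomputable section

open Set Filter MeasureTheory Literature.NumberTheory.LFunctions
open Summit.RiemannHypothesis.RiemannHypothesis.Theorems.Handoff
open scoped ComplexConjugate

namespace Summit.RiemannHypothesis.RiemannHypothesis.Theorems.HandoffEdgeLayer

variable {g : ℝ → ℂ} {q q' : ℕ}

/-- **`|contribution_q(g)| ≤ cap(q)·‖g‖₂²`, `cap(q) = (log q)/√q`**, for every test `g ∈ C(t)` with `t < log q`: the contribution of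
the place `q` is at most half the atom weight `w_q = 2 log q/√q` times `‖g‖₂²` (the factor ½ is sharp; attained by antisymmetric
two-layer pairs — HANDOFF-STATEMENT §A.4, on paper). [cite: ConnesConsani2023, §2.2–§2.3 (the contribution of the prime 2 on log 2 ≤ L < log 3); sharp cap: this track] -/
theorem abs_contribution_le (hg : IsWeilTest g) {t : ℝ} (hsupp : tsupport g ⊆ Icc (-t) t) (ht : t < Real.log q) :
    |contribution q g| ≤ Real.log q / Real.sqrt q * ∫ u : ℝ, ‖g u‖ ^ 2 := by
  have hr : 0 ≤ Real.log q / Real.sqrt q := div_nonneg (Real.log_natCast_nonneg q) (Real.sqrt_nonneg _)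
  have hre : |(weilConv g (weilReflect g) (Real.log q) + weilConv g (weilReflect g) (-Real.log q)).re| ≤
      ∫ u : ℝ, ‖g u‖ ^ 2 :=
    (Complex.abs_re_le_norm _).trans (norm_weilConv_weilReflect_add_neg_le hg hsupp ht)
  unfold contribution
  rw [abs_neg, abs_mul, abs_of_nonneg hr]
  exact mul_le_mul_of_nonneg_left hre hr

/-- For consecutive primes `q < q'`: `q' < q²` (Bertrand `q' ≤ 2q ≤ q²`, and `q²` is not prime). [folklore] -/
theorem _root_.Summit.RiemannHypothesis.RiemannHypothesis.Theorems.Handoff.ConsecutivePrimes.lt_sq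
    (h : ConsecutivePrimes q q') : q' < q ^ 2 := by
  have hle : q' ≤ q ^ 2 := Nat.le_of_pred_lt h.pred_lt_sq
  rcases hle.lt_or_eq with hlt | heq
  · exact hlt
  · exact absurd (heq ▸ h.2.1) (Nat.Prime.not_prime_pow le_rfl)

/-- Hence the whole window of `q` lies strictly below `log q`: `(log q')/2 < log q`. [folklore] -/
theorem _root_.Summit.RiemannHypothesis.RiemannHypothesis.Theorems.Handoff.ConsecutivePrimes.log_half_lt_log
    (h : ConsecutivePrimes q q') : Real.log q' / 2 < Real.log q := by
  have hq' : (0 : ℝ) < q' := by exact_mod_cast h.2.1.pos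
  have hlt : (q' : ℝ) < (q : ℝ) ^ 2 := by exact_mod_cast h.lt_sq
  have := Real.log_lt_log hq' hlt
  rw [Real.log_pow] at this
  push_cast at this
  linarith

/-- **On the handoff window `|contribution_q(g)| ≤ cap(q)‖g‖₂²`** for every test `g ∈ C(b)`, `b ≤ (log q')/2`.
[cite: ConnesConsani2023, §2.2–§2.3; sharp cap: this track] -/
theorem abs_contribution_le_of_window (h : ConsecutivePrimes q q') (hg : IsWeilTest g) {b : ℝ}
    (hb : b ≤ Real.log q' / 2) (hsupp : tsupport g ⊆ Icc (-b) b) :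
    |contribution q g| ≤ Real.log q / Real.sqrt q * ∫ u : ℝ, ‖g u‖ ^ 2 :=
  abs_contribution_le hg hsupp (lt_of_le_of_lt hb h.log_half_lt_log)

/-- **The SHARP aggregate necessary condition**: `H(q)` implies `deficit_q(g) ≤ cap(q)·‖g‖₂²` for every `b` in the window and
every `g ∈ C(b)` — i.e. `λ_min(S_q; b) ≥ −(log q)/√q`, the ceiling `r ≤ 1` of the load `r = D_q/cap(q)` (HANDOFF-STATEMENT §D.2 with the
sharp constant; conj-1 PREREG-H7-H11's object). NOT conversely (§D.3). [cite: Bombieri2000Weil, §4 (windows); sharp cap: this track] -/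
theorem deficit_le_cap_of_handoffH (h : ConsecutivePrimes q q') (H : HandoffH q q') (hg : IsWeilTest g) {b : ℝ}
    (hb : b ∈ Icc (Real.log q / 2) (Real.log q' / 2)) (hsupp : tsupport g ⊆ Icc (-b) b) :
    deficit q g ≤ Real.log q / Real.sqrt q * ∫ u : ℝ, ‖g u‖ ^ 2 :=
  (H b hb g hg hsupp).trans ((le_abs_self _).trans (abs_contribution_le_of_window h hg hb.2 hsupp))

/-- **RH ⟹ `deficit_q ≤ cap(q)‖g‖₂²` on every window** (the sharp `N(q)` for every prime `q`; a certified violation would refute RH).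
[cite: Bombieri2000Weil, Thm 2 (p. 193); sharp cap: this track] -/
theorem deficit_le_cap_of_riemannHypothesis (hRH : RiemannHypothesis) (h : ConsecutivePrimes q q') (hg : IsWeilTest g)
    {b : ℝ} (hb : b ∈ Icc (Real.log q / 2) (Real.log q' / 2)) (hsupp : tsupport g ⊆ Icc (-b) b) :
    deficit q g ≤ Real.log q / Real.sqrt q * ∫ u : ℝ, ‖g u‖ ^ 2 :=
  deficit_le_cap_of_handoffH h ((riemannHypothesis_iff_forall_handoffH.1 hRH) q q' h) hg hb hsupp

end Summit.RiemannHypothesis.RiemannHypothesis.Theorems.HandoffEdgeLayer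

end
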